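import Summits.ABC.ABC.Theses.TwistAmplification
import Literature.NumberTheory.DiophantineGeometry.AbcShapeReductionCount
import Literature.NumberTheory.DiophantineGeometry.AbcExceptionalSetBounds

-- Summit.ABC.ABC is the mandated summit-side namespace (single-conjunct summit); the lakefile sets the same option tree-wide.
set_option linter.dupNamespace false

/-!
# The transfer "box law at every `s' ∈ (1,2)` ⟹ `MazurKaneLaw`" (crux stmt-ABC-2757, stub `shapeTransfer`)

Stub S1 of the line `fibre-toolkit-lp-wall-map` for the crux
`Summit.ABC.ABC.Theses.TwistAmplification.MazurKaneLaw`
(`∀ s ∈ (1,2) ∀ ε > 0 ∃ C ∀ N ≥ 2, #{abc triples (a,b,c) : c ≤ N, rad(abc) ≤ c^s} ≤ C · N^{s-1+ε}`).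

The line reduces the crux to a BOX LAW for the Bernert–Browning–Lichtman–Teräväinen shape counts
`B_M(c; X, Y, Z) = AbcShapes.shapeCount` on admissible data (`AbcShapes.Admissible`): if for every
`s' ∈ (1,2)` and `η > 0` there is `ε₀ > 0` such that for all `0 < ε' ≤ ε₀` one has
`B_M ≤ K · C₀^{s'-1+η}` on `Admissible s' ε'` data, then the crux holds. This file is that transfer
(`Summit.ABC.ABC.Theorems.MazurKaneLaw.shapeTransfer`), on the pattern of
`bernertEtAl2024_thm_1_3_holds`:

* given `1 < s < 2` and `ε > 0` put `s' = min(s + ε/3, (s+2)/2)`, so `s < s' < 2` and `s' ≤ s + ε/3`;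
* the box law at `(s', η = ε/3)` gives `ε₀`; take `ε' = min(ε₀, ε/9, 1/4)` and the constant `K`;
* `AbcShapes.abcExponentCount_le_of_shapeCount_le` (BBLT Prop. 2.1) bounds `N_{s'}(N)` by
  `K · #classRange ε' N · N^{s'-1+ε/3}`, and `AbcShapes.card_classRange_le ε' (δ := ε/9)` bounds the
  number of classes by `C · N^{3ε'/2+ε/9}`; the exponents add up to at most `s - 1 + ε`;
* finally, for an abc triple `c ≥ 2`, so `rad(abc) ≤ c^s < c^{s'}`: the set of the crux at `(s, N)`
  is contained in the set counted by `abcExponentCount s' N` (this absorbs `≤` versus `<`).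
-/

namespace Summit.ABC.ABC.Theorems.MazurKaneLaw

open Literature.NumberTheory.DiophantineGeometry
open Literature.NumberTheory.DiophantineGeometry.AbcShapes

/-- **Transfer of the box law to the crux `MazurKaneLaw`.** If for every `s' ∈ (1,2)` and `η > 0`
there is `ε₀ > 0` such that for all `0 < ε' ≤ ε₀` the shape counts satisfy
`B_M(c; X, Y, Z) ≤ K · C₀^{s'-1+η}` on all `Admissible s' ε'` data (`M = numShapes ε'`), then
`#{abc triples, c ≤ N, rad(abc) ≤ c^s} ≤ C · N^{s-1+ε}` for every `1 < s < 2`, `ε > 0`, `N ≥ 2`.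
Proof: `s' = min(s + ε/3, (s+2)/2)`, `η = ε/3`, `ε' = min(ε₀, ε/9, 1/4)`; the reduction
`abcExponentCount_le_of_shapeCount_le` and the class count `card_classRange_le ε' (δ := ε/9)` give
`N_{s'}(N) ≤ K C · N^{3ε'/2 + ε/9 + s' - 1 + ε/3} ≤ K C · N^{s-1+ε}`, and the crux's set lies in the
set of `N_{s'}(N)` because `rad(abc) ≤ c^s < c^{s'}` (`c ≥ 2`). [folklore] -/
theorem shapeTransfer : (∀ s : ℝ, 1 < s → s < 2 → ∀ η : ℝ, 0 < η → ∃ ε₀ : ℝ, 0 < ε₀ ∧ ∀ ε' : ℝ, 0 < ε' → ε' ≤ ε₀ → ∃ K : ℝ, 0 ≤ K ∧ ∀ (C₀ c₁ c₂ c₃ : ℕ) (X Y Z : Fin (Literature.NumberTheory.DiophantineGeometry.AbcShapes.numShapes ε') → ℕ), Literature.NumberTheory.DiophantineGeometry.AbcShapes.Admissible s ε' C₀ c₁ c₂ c₃ X Y Z → (Literature.NumberTheory.DiophantineGeometry.AbcShapes.shapeCount c₁ c₂ c₃ X Y Z : ℝ) ≤ K * (C₀ : ℝ) ^ (s - 1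 + η)) → Summit.ABC.ABC.Theses.TwistAmplification.MazurKaneLaw := by
  intro hBox
  unfold Summit.ABC.ABC.Theses.TwistAmplification.MazurKaneLaw
  intro s hs1 hs2 ε hε
  -- the auxiliary exponent `s' ∈ (s, 2)` with `s' ≤ s + ε/3`
  obtain ⟨s', hs'⟩ : ∃ t : ℝ, t = min (s + ε / 3) ((s + 2) / 2) := ⟨_, rfl⟩
  have hss' : s < s' := by rw [hs']; exact lt_min (by linarith) (by linarith)
  have hs'2 : s' < 2 := by rw [hs']; exact (min_le_right _ _).trans_lt (by linarith)
  have hs'ε : s' ≤ s + ε / 3 := by rw [hs']; exact min_le_left _ _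
  have hs'1 : 1 < s' := hs1.trans hss'
  have hη : 0 < ε / 3 := by positivity
  -- the box law at `(s', η = ε/3)`
  obtain ⟨ε₀, hε₀, hK⟩ := hBox s' hs'1 hs'2 (ε / 3) hη
  -- the small parameter `ε'`
  obtain ⟨ε', hε'⟩ : ∃ t : ℝ, t = min (min ε₀ (ε / 9)) (1 / 4) := ⟨_, rfl⟩
  have hε'0 : 0 < ε' := by
    rw [hε']; exact lt_min (lt_min hε₀ (by positivity)) (by norm_num)
  have hε'ε₀ : ε' ≤ ε₀ := by rw [hε']; exact (min_le_left _ _).trans (min_le_left _ _)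
  have hε'ε : ε' ≤ ε / 9 := by rw [hε']; exact (min_le_left _ _).trans (min_le_right _ _)
  have hε'4 : ε' ≤ 1 / 4 := by rw [hε']; exact min_le_right _ _
  have hε'2 : ε' < 1 / 2 := by linarith
  obtain ⟨K, hK0, hB⟩ := hK ε' hε'0 hε'ε₀
  have hl0 : (0 : ℝ) ≤ s' := by linarith
  have hθ0 : (0 : ℝ) ≤ s' - 1 + ε / 3 := by linarith
  -- the reduction to shape counts and the number of classes
  have hred := abcExponentCount_le_of_shapeCount_le hε'0 hε'2 hl0 hθ0 hK0 hB
  obtain ⟨C, hC0, hC⟩ := card_classRange_le ε' (δ := ε / 9) (by positivity)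
  refine ⟨K * C, fun N hN => ?_⟩
  have hN1 : (1 : ℝ) ≤ N := by exact_mod_cast (show 1 ≤ N by omega)
  have hN0 : (0 : ℝ) < N := by positivity
  -- the crux's set at `(s, N)` lies in the set counted by `abcExponentCount s' N` (`c ≥ 2`)
  have hsub : {t : ℕ × ℕ × ℕ | IsABCTriple t.1 t.2.1 t.2.2 ∧ t.2.2 ≤ N ∧
      ((rad t.1 t.2.1 t.2.2 : ℕ) : ℝ) ≤ (t.2.2 : ℝ) ^ s} ⊆
      {t : ℕ × ℕ × ℕ | IsABCTriple t.1 t.2.1 t.2.2 ∧ t.2.2 ≤ N ∧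
        ((rad t.1 t.2.1 t.2.2 : ℕ) : ℝ) < (t.2.2 : ℝ) ^ s'} := by
    rintro t ⟨ht, hN', hle⟩
    refine ⟨ht, hN', hle.trans_lt ?_⟩
    have h2 : (1 : ℝ) < (t.2.2 : ℝ) := by
      obtain ⟨ha, hb, habc, -⟩ := ht
      have : 2 ≤ t.2.2 := by omega
      exact_mod_cast this
    exact Real.rpow_lt_rpow_of_exponent_lt h2 hss'
  have h1 : (Set.ncard {t : ℕ × ℕ × ℕ | IsABCTriple t.1 t.2.1 t.2.2 ∧ t.2.2 ≤ N ∧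
      ((rad t.1 t.2.1 t.2.2 : ℕ) : ℝ) ≤ (t.2.2 : ℝ) ^ s} : ℝ) ≤ (abcExponentCount s' N : ℝ) := by
    rw [abcExponentCount_def]
    exact_mod_cast Set.ncard_le_ncard hsub (abcExponentCount_finite _ N)
  -- the exponents: `3ε'/2 + ε/9 + s' - 1 + ε/3 ≤ s - 1 + ε`
  have hexp : (N : ℝ) ^ (3 * ε' / 2 + ε / 9) * (N : ℝ) ^ (s' - 1 + ε / 3) ≤
      (N : ℝ) ^ (s - 1 + ε) := by
    rw [← Real.rpow_add hN0]
    exact Real.rpow_le_rpow_of_exponent_le hN1 (by linarith)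
  calc (Set.ncard {t : ℕ × ℕ × ℕ | IsABCTriple t.1 t.2.1 t.2.2 ∧ t.2.2 ≤ N ∧
          ((rad t.1 t.2.1 t.2.2 : ℕ) : ℝ) ≤ (t.2.2 : ℝ) ^ s} : ℝ)
        ≤ (abcExponentCount s' N : ℝ) := h1
    _ ≤ K * (classRange ε' N).card * (N : ℝ) ^ (s' - 1 + ε / 3) := hred N
    _ ≤ K * (C * (N : ℝ) ^ (3 * ε' / 2 + ε / 9)) * (N : ℝ) ^ (s' - 1 + ε / 3) :=
        mul_le_mul_of_nonneg_right (mul_le_mul_of_nonneg_left (hC N hN) hK0) (by positivity)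
    _ = K * C * ((N : ℝ) ^ (3 * ε' / 2 + ε / 9) * (N : ℝ) ^ (s' - 1 + ε / 3)) := by ring
    _ ≤ K * C * (N : ℝ) ^ (s - 1 + ε) := mul_le_mul_of_nonneg_left hexp (mul_nonneg hK0 hC0.le)

end Summit.ABC.ABC.Theorems.MazurKaneLaw
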